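import Summits.CriticalPhenomena.PercolationContinuityZ3.Theorems.SahiTP2Kernel

/-!
# TP₂ across cuts ⟺ conditionally increasing: the converse, and the intrinsic characterisation of CIS laws

Companion of `SahiTP2Kernel.lean` (cell `prim-sahi`, typer seat, generation 10; `--supports stmt-CriticalPhenomena-4575`).
Mathlib only.

* `IsTP2Cut.compProd_of_anti` — the elementary converse: if `κ` is a Markov kernel that is stochastically increasing
  (`a ≤ b ⇒ κ_b(L) ≤ κ_a(L)` for every measurable lower set `L`), then `μ₁ ⊗ₘ κ` is TP₂ across cuts (pointwise
  `(1-u)v ≤ u(1-v)` for `v ≤ u`, integrated over `[a₁,b₁] × [a₂,b₂]`).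
* `measure_lowerSet_le_of_Iic` — on `ℝ`, stochastic monotonicity on the half-lines `(-∞,t]` propagates to every lower
  set (`∅`, `ℝ`, `(-∞,c]`, `(-∞,c)`).
* `isTP2Cut_iff_exists_cisKernel` — for a finite measure `ρ` on `ℝ × ℝ` carried by a strip `ℝ × [y₀,y₁]`:
  **`ρ` is TP₂ across cuts iff it is conditionally increasing**, i.e. iff `ρ = ρ.fst ⊗ₘ κ` for a Markov kernel `κ`
  with `a ↦ κ_a((-∞,t])` antitone for every `t` (`SahiTP2Kernel.exists_cisKernel` is the hard direction).  So
  `IsTP2Cut` is an intrinsic description — no disintegration mentioned — of the conditionally increasing (positively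
  regression dependent) laws, valid for singular measures.

No sorries, no new axioms.  (`CIS ⇒ association` is Barlow–Proschan's classical route; the order-`n` consequences are
in `SahiTP2Positivity.lean`.)
-/

noncomputable section

namespace Summit.CriticalPhenomena.PercolationContinuityZ3.Theorems.SahiTP2

open MeasureTheory ProbabilityTheory Set Filter Topology Function
open scoped ENNReal

/-! ## The converse: conditionally increasing laws are TP₂ across cuts -/

/-- **Conditionally increasing ⇒ TP₂ across cuts.**  If the Markov kernel `κ` is stochastically increasing on
measurable lower sets, then `μ₁ ⊗ₘ κ` satisfies `IsTP2Cut`. [this work] -/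
theorem IsTP2Cut.compProd_of_anti {α β : Type*} [Preorder α] [TopologicalSpace α] [OrderClosedTopology α]
    [MeasurableSpace α] [OpensMeasurableSpace α] [Preorder β] [MeasurableSpace β] (μ₁ : Measure α) [SFinite μ₁]
    (κ : Kernel α β) [IsMarkovKernel κ]
    (hκ : ∀ ⦃a b : α⦄, a ≤ b → ∀ ⦃L : Set β⦄, IsLowerSet L → MeasurableSet L → κ b L ≤ κ a L) :
    IsTP2Cut (μ₁ ⊗ₘ κ) := by
  intro a₁ b₁ a₂ b₂ hlt L hL hLm
  have hmL : Measurable fun a => κ a L := κ.measurable_coe hLm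
  have hmLc : Measurable fun a => κ a Lᶜ := κ.measurable_coe hLm.compl
  rw [Measure.compProd_apply_prod measurableSet_Icc hLm.compl, Measure.compProd_apply_prod measurableSet_Icc hLm,
    Measure.compProd_apply_prod measurableSet_Icc hLm, Measure.compProd_apply_prod measurableSet_Icc hLm.compl,
    ← lintegral_lintegral_mul hmLc.aemeasurable hmL.aemeasurable,
    ← lintegral_lintegral_mul hmL.aemeasurable hmLc.aemeasurable]
  refine setLIntegral_mono' measurableSet_Icc fun x hx => setLIntegral_mono' measurableSet_Icc fun x' hx' => ?_
  have hxx' : x ≤ x' := hx.2.trans (hlt.le.trans hx'.1)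
  have hvu : κ x' L ≤ κ x L := hκ hxx' hL hLm
  rw [prob_compl_eq_one_sub hLm, prob_compl_eq_one_sub hLm]
  calc (1 - κ x L) * κ x' L ≤ (1 - κ x' L) * κ x L := mul_le_mul' (tsub_le_tsub_left hvu 1) hvu
    _ = κ x L * (1 - κ x' L) := mul_comm _ _

/-! ## Lower sets of `ℝ` and stochastic monotonicity -/

/-- A lower set of `ℝ` is empty, everything, a closed half-line or an open half-line. [folklore] -/
theorem isLowerSet_real_cases {L : Set ℝ} (hL : IsLowerSet L) :
    L = ∅ ∨ L = univ ∨ ∃ c : ℝ, L = Iic c ∨ L = Iio c := by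
  rcases L.eq_empty_or_nonempty with h | hne
  · exact Or.inl h
  by_cases hb : BddAbove L
  · refine Or.inr (Or.inr ⟨sSup L, ?_⟩)
    by_cases hc : sSup L ∈ L
    · exact Or.inl (Subset.antisymm (fun x hx => le_csSup hb hx) fun x hx => hL hx hc)
    · refine Or.inr (Subset.antisymm (fun x hx => lt_of_le_of_ne (le_csSup hb hx) fun h => hc (h ▸ hx))
        fun x hx => ?_)
      obtain ⟨y, hy, hxy⟩ := exists_lt_of_lt_csSup hne (mem_Iio.1 hx)
      exact hL hxy.le hy
  · refine Or.inr (Or.inl (eq_univ_of_forall fun x => ?_))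
    obtain ⟨y, hy, hxy⟩ := not_bddAbove_iff.1 hb x
    exact hL hxy.le hy

/-- An open half-line is the increasing union of the closed half-lines `(-∞, c - 1/(n+1)]`. [folklore] -/
theorem Iio_eq_iUnion_Iic (c : ℝ) : Iio c = ⋃ n : ℕ, Iic (c - 1 / ((n : ℝ) + 1)) := by
  ext x
  simp only [mem_Iio, mem_iUnion, mem_Iic]
  constructor
  · intro hx
    obtain ⟨n, hn⟩ := exists_nat_one_div_lt (sub_pos.2 hx)
    exact ⟨n, by linarith⟩
  · rintro ⟨n, hn⟩
    have : (0 : ℝ) < 1 / ((n : ℝ) + 1) := by positivity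
    linarith

/-- **Stochastic monotonicity on half-lines propagates to all lower sets**: for probability measures `ν, ν'` on `ℝ`
with `ν((-∞,t]) ≤ ν'((-∞,t])` for all `t`, `ν(L) ≤ ν'(L)` for every lower set `L`. [folklore] -/
theorem measure_lowerSet_le_of_Iic (ν ν' : Measure ℝ) [IsProbabilityMeasure ν] [IsProbabilityMeasure ν']
    (h : ∀ t : ℝ, ν (Iic t) ≤ ν' (Iic t)) {L : Set ℝ} (hL : IsLowerSet L) : ν L ≤ ν' L := by
  rcases isLowerSet_real_cases hL with rfl | rfl | ⟨c, rfl | rfl⟩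
  · simp
  · simp
  · exact h c
  · have hmono : Monotone fun n : ℕ => Iic (c - 1 / ((n : ℝ) + 1)) := by
      intro n n' hnn'
      refine Iic_subset_Iic.2 (sub_le_sub_left (one_div_le_one_div_of_le (by positivity) ?_) c)
      exact add_le_add_left (Nat.cast_le.2 hnn') 1
    rw [Iio_eq_iUnion_Iic, hmono.measure_iUnion, hmono.measure_iUnion]
    exact iSup_mono fun n => h _

/-- A stochastically increasing Markov kernel on `ℝ` (on half-lines) is stochastically increasing on every measurable
lower set. [folklore] -/
theorem kernel_anti_lowerSet (κ : Kernel ℝ ℝ) [IsMarkovKernel κ]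
    (hκ : ∀ ⦃a b : ℝ⦄, a ≤ b → ∀ t : ℝ, κ b (Iic t) ≤ κ a (Iic t)) ⦃a b : ℝ⦄ (hab : a ≤ b) ⦃L : Set ℝ⦄
    (hL : IsLowerSet L) : κ b L ≤ κ a L :=
  measure_lowerSet_le_of_Iic (κ b) (κ a) (hκ hab) hL

/-! ## The characterisation -/

/-- **TP₂ across cuts ⟺ conditionally increasing.**  A finite measure on `ℝ × ℝ` carried by a horizontal strip
`ℝ × [y₀, y₁]` is TP₂ across cuts iff it is the composition-product of its first marginal with a stochastically
increasing Markov kernel (an everywhere monotone version of its conditional law). [this work] -/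
theorem isTP2Cut_iff_exists_cisKernel (ρ : Measure (ℝ × ℝ)) [IsFiniteMeasure ρ] {y₀ y₁ : ℝ} (hy : y₀ ≤ y₁)
    (hY : ∀ᵐ p ∂ρ, p.2 ∈ Icc y₀ y₁) :
    IsTP2Cut ρ ↔ ∃ κ : Kernel ℝ ℝ, IsMarkovKernel κ ∧ ρ.fst ⊗ₘ κ = ρ ∧
      ∀ ⦃a b : ℝ⦄, a ≤ b → ∀ t : ℝ, κ b (Iic t) ≤ κ a (Iic t) := by
  refine ⟨fun hρ => exists_cisKernel hρ hy hY, ?_⟩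
  rintro ⟨κ, hκM, hdis, hκ⟩
  rw [← hdis]
  exact IsTP2Cut.compProd_of_anti ρ.fst κ fun a b hab L hL _ => kernel_anti_lowerSet κ hκ hab hL

/-- **Every conditionally increasing law on `ℝ²` is TP₂ across cuts** (no strip hypothesis needed in this
direction). [this work] -/
theorem IsTP2Cut.compProd_real (μ₁ : Measure ℝ) [SFinite μ₁] (κ : Kernel ℝ ℝ) [IsMarkovKernel κ]
    (hκ : ∀ ⦃a b : ℝ⦄, a ≤ b → ∀ t : ℝ, κ b (Iic t) ≤ κ a (Iic t)) : IsTP2Cut (μ₁ ⊗ₘ κ) :=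
  IsTP2Cut.compProd_of_anti μ₁ κ fun _ _ hab _ hL _ => kernel_anti_lowerSet κ hκ hab hL

end Summit.CriticalPhenomena.PercolationContinuityZ3.Theorems.SahiTP2
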